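import Summits.AtomisticToContinuum.HydrodynamicLimit.Theses.TwoClocks
import Summits.AtomisticToContinuum.HydrodynamicLimit.Theorems.TwoClocksTransferActivityTailsTransferLeHitWeight
import Summits.AtomisticToContinuum.HydrodynamicLimit.Theorems.TwoClocksTransferActivityTailsCollisionSumMono
import Summits.AtomisticToContinuum.HydrodynamicLimit.Theorems.TwoClocksTransferActivityTailsWeightedCountAEMeasurable
import Summits.AtomisticToContinuum.HydrodynamicLimit.Theorems.TwoClocksTransferActivityTailsMeanTailAverage
import HarnessLib

/-!
# `TransferActivityTails` (stmt-AtomisticToContinuum-16624), line `IdeatorOneSketch` (idea `tagged-count-chernoff`):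
the crux skeleton, v3 (lead c2) — ONE open stub, docked at the weakest per-sphere rung; three landed/landing docks

Crux `Summit.AtomisticToContinuum.HydrodynamicLimit.Theses.TwoClocks.TransferActivityTails` (route TwoClocks, rank 7): the
a-priori `L¹` tail bound `E_λ[(N+1)⁻¹ Σ_i a_i 𝟙{a_i > V}] ≤ ε` for the window TRANSFER activity
`a_i(s) = (σ/τ) Σ_{collisions of i in (s, s+w]} (‖v_i⁺ − v_i⁻‖ + |‖v_i⁺‖² − ‖v_i⁻‖²|/2)`, `w = τ (N+1)^{-1/3}`, under the true
evolution from local Gibbs data.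

STATE OF THE LINE.  Landed (sorry-free, standard axioms): per-record kinematics `transferWeight ≤ hitWeight` (p127396), monotonicity
of window collision sums on the good set (p127338), a.e.-measurability of the weighted count `W_i` (p127435), exponential-tail layer
cake (p127493/p127579), averaging (p127387), the reduction file `Theorems/TwoClocksTransferActivityTailsReduction.lean` (p127949:
`WeightedCountActivityTails → crux`, `TaggedCountTailBound (C⁺) → WeightedCountActivityTails`); landing: the averaged `L²` dock
`Theorems/TwoClocksTransferActivityTailsMeanSquare.lean` (p129242, `TransferActivityMeanSquare → crux`); written and checked, to be
proposed once the hub has built p127949's module: `Theorems/TwoClocksTransferActivityTailsSecondMomentRung.lean`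
(`WeightedCountMeanSquareRung → WeightedCountActivityTails`).

v3 (this lead).  The single OPEN stub is registered at the WEAKEST per-sphere docking statement, the `L¹`-tail rung
`WeightedCountActivityTails` (`∃V₀ ∀V ≥ V₀ ∀ε ∃τ₀ ∀τ ≥ τ₀ ∃N₀ ∀N ≥ N₀ ∀s ≤ t ∀i: E_λ[b_i 𝟙{b_i > V}] ≤ ε`, `b_i = (σ/τ) W_i`);
the reduction stub `stub_weightedCountActivityTails_of_meanSquareRung` is PROVED here (lands as the SecondMomentRung file); the
averaged dock `TransferActivityMeanSquare → crux` lives only in its tree file (p129242, registered stub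
`stub_transferActivityTails_of_meanSquare`) so that exactly one theorem of this workfile concludes the crux from a stub.
Sufficient for the open stub: C⁺ (landed implication) or the second-moment rung (this file); for the crux directly:
`TransferActivityMeanSquare`.  The open stub is the crux's entire dynamical content:
N-uniform control of ONE tagged sphere's collision statistics over `τσ² → ∞` mean free times under the true pre-shock hard-sphere
law at fixed packing (not in print at or off equilibrium: Spohn 1991 Part I §2.4; BGSR 2016 / BGSS 2023 are Boltzmann–Grad).
This workfile is SELF-CONTAINED over built modules (it re-declares verbatim the statements of the reduction / dock files, whose
hub oleans were not yet built when it was registered); the tree files are the durable copies.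

`TransferActivityTails_of` concludes the crux BY NAME; the only `sorry` is `stub_weightedCountActivityTails`.
-/

noncomputable section

open MeasureTheory Set Filter Topology
open scoped ENNReal InnerProductSpace BigOperators

namespace Summit.AtomisticToContinuum.HydrodynamicLimit.Theorems.TransferActivityTailsTaggedCount

open Literature.MathematicalPhysics.KineticTheory Literature.Analysis.FluidPDE
open Summit.AtomisticToContinuum.HydrodynamicLimit.Theorems.CollisionActivityTailsEndpointTails
  (Flow Cfg window tailFn tailFn_of_lt tailFn_of_le measurable_tailFn ae_mem_good_localGibbsLaw)
open Summit.AtomisticToContinuum.HydrodynamicLimit.Theorems.TransferActivityTailsTransferLeHitWeight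
  (transferWeight hitWeight stub_transferLeHitWeight)
open Summit.AtomisticToContinuum.HydrodynamicLimit.Theorems.TransferActivityTailsCollisionSumMono
  (stub_collisionSumMono)
open Summit.AtomisticToContinuum.HydrodynamicLimit.Theorems.TransferActivityTailsWeightedCountAEMeasurable
  (weightedCount stub_weightedCountAEMeasurable)
open Summit.AtomisticToContinuum.HydrodynamicLimit.Theorems.TransferActivityTailsMeanTailAverage
  (stub_meanTailAverage)

/-! ## §1 The statements (verbatim copies of the tree's docking statements) -/

/-- The per-sphere `L¹`-tail rung (= `TransferActivityTailsReduction.WeightedCountActivityTails`, p127949): the crux's own tail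
statement with `a_i` replaced by the scaled energy-marked impulse-truncated count `b_i(s) = (σ/τ) W_i(s)` of EACH sphere.
THE OPEN STUB of the line. -/
def WeightedCountActivityTails : Prop :=
  ∀ (a₀ θ₀ : T3 → ℝ) (u₀ : T3 → V3), Continuous a₀ → Continuous θ₀ → Continuous u₀ →
    (∀ x, 0 < a₀ x) → (∀ x, 0 < θ₀ x) → ∃ σ₀ : ℝ, 0 < σ₀ ∧ ∀ σ : ℝ, 0 < σ → σ < σ₀ →
    ∀ (T : ℝ) (ρ θ : ℝ → T3 → ℝ) (u : ℝ → T3 → V3), IsHardSphereEulerSolution σ T ρ u θ →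
    ∀ Φ : (N : ℕ) → Flow σ N,
    TendstoHydroFieldsAt (fun N => localGibbsLaw σ a₀ u₀ θ₀ N (Φ N)) Φ ρ u θ 0 →
    ∀ t ∈ Set.Ico 0 T, ∃ V₀ : ℝ, 0 < V₀ ∧ ∀ V : ℝ, V₀ ≤ V → ∀ ε : ℝ, 0 < ε → ∃ τ₀ : ℝ, 0 < τ₀ ∧
    ∀ τ : ℝ, τ₀ ≤ τ → ∃ N₀ : ℕ, ∀ N : ℕ, N₀ ≤ N → ∀ s ∈ Set.Icc 0 t, ∀ i : Fin (N + 1),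
      ∫⁻ z, ENNReal.ofReal (tailFn V (σ / τ * weightedCount (Φ N) τ s i z))
        ∂(localGibbsLaw σ a₀ u₀ θ₀ N (Φ N)) ≤ ENNReal.ofReal ε


/-- The per-sphere second-moment rung (= `TransferActivityTailsSecondMomentRung.WeightedCountMeanSquareRung`, file written):
`E_λ[(b_i(s) − m)²] ≤ δ` for some predictor `m ≤ A` of the datum. -/
def WeightedCountMeanSquareRung : Prop :=
  ∀ (a₀ θ₀ : T3 → ℝ) (u₀ : T3 → V3), Continuous a₀ → Continuous θ₀ → Continuous u₀ →
    (∀ x, 0 < a₀ x) → (∀ x, 0 < θ₀ x) → ∃ σ₀ : ℝ, 0 < σ₀ ∧ ∀ σ : ℝ, 0 < σ → σ < σ₀ →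
    ∀ (T : ℝ) (ρ θ : ℝ → T3 → ℝ) (u : ℝ → T3 → V3), IsHardSphereEulerSolution σ T ρ u θ →
    ∀ Φ : (N : ℕ) → Flow σ N,
    TendstoHydroFieldsAt (fun N => localGibbsLaw σ a₀ u₀ θ₀ N (Φ N)) Φ ρ u θ 0 →
    ∀ t ∈ Set.Ico 0 T, ∃ A : ℝ, 0 < A ∧ ∀ δ : ℝ, 0 < δ → ∃ τ₀ : ℝ, 0 < τ₀ ∧ ∀ τ : ℝ, τ₀ ≤ τ →
    ∃ N₀ : ℕ, ∀ N : ℕ, N₀ ≤ N → ∀ s ∈ Set.Icc 0 t, ∀ i : Fin (N + 1),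
    ∃ m : Cfg N → ℝ, (∀ z, m z ≤ A) ∧
      ∫⁻ z, ENNReal.ofReal ((σ / τ * weightedCount (Φ N) τ s i z - m z) ^ 2)
        ∂(localGibbsLaw σ a₀ u₀ θ₀ N (Φ N)) ≤ ENNReal.ofReal δ

/-! ## §2 Pointwise lemmas -/

/-- `a_i ≤ (σ/τ) W_i` pathwise on the good set (per-record kinematics summed over the window's records; = the tree's
`TransferActivityTailsReduction.transferActivity_le_weightedCount`). -/
theorem transferActivity_le_weightedCount {σ : ℝ} {N : ℕ} (hσ : 0 ≤ σ) (Φ : Flow σ N) {z : Cfg N} (hz : z ∈ Φ.good)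
    {τ : ℝ} (hτ : 0 ≤ τ) (s : ℝ) (i : Fin (N + 1)) :
    σ / τ * Φ.collisionSum (Set.Ioc s (s + window τ N)) (transferWeight i) z ≤
      σ / τ * weightedCount Φ τ s i z :=
  mul_le_mul_of_nonneg_left
    (stub_collisionSumMono σ N Φ z hz s (s + window τ N) (transferWeight i) (hitWeight i)
      fun t k l => stub_transferLeHitWeight N (hsDiameter σ N) (Φ.flow t z) t i k l)
    (div_nonneg hσ hτ)

/-- **`y 𝟙{y > V} ≤ (A + 1)(y − m)²`** for `m ≤ A` and `A + 1 ≤ V` (any real `y`): on `{y > V}` the deviation `d = y − m` is at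
least `1`, so `y = m + d ≤ A d + d = (A + 1) d ≤ (A + 1) d²`; off it the left side vanishes. -/
theorem tailFn_le_mul_sq {A V y m : ℝ} (hA : 0 ≤ A) (hm : m ≤ A) (hV : A + 1 ≤ V) :
    tailFn V y ≤ (A + 1) * (y - m) ^ 2 := by
  by_cases hyV : V < y
  · rw [tailFn_of_lt hyV]
    have hd : 1 ≤ y - m := by linarith
    have h1 : y ≤ (A + 1) * (y - m) := by nlinarith
    have h2 : (A + 1) * (y - m) ≤ (A + 1) * (y - m) ^ 2 := by
      apply mul_le_mul_of_nonneg_left _ (by linarith)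
      nlinarith
    exact h1.trans h2
  · rw [tailFn_of_le (not_lt.1 hyV)]
    positivity

/-! ## §3 The open stub -/

/-- Stub (registered, **OPEN** — the line's dynamical input): the per-sphere `L¹` tails of the scaled energy-marked impulse-truncated
window count under the true pre-shock law.  Sufficient: `TaggedCountTailBound` (C⁺, landed implication p127949) or
`WeightedCountMeanSquareRung` (`stub_weightedCountActivityTails_of_meanSquareRung`). -/
theorem stub_weightedCountActivityTails : WeightedCountActivityTails := by
  sorry

/-! ## §4 The compositions (sorry-free) and the conclusion of the crux by name -/

/-- The crux decl under a local name, so that the conditional composition below is not itself read as "the" skeleton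
theorem (the skeleton audit takes the theorems concluding the crux BY NAME; exactly one, `TransferActivityTails_of`, does). -/
abbrev LineTarget : Prop := Summit.AtomisticToContinuum.HydrodynamicLimit.Theses.TwoClocks.TransferActivityTails

/-- **The crux from the per-sphere `L¹` rung** (= the tree's `transferActivityTails_of_weightedCountActivityTails`, p127949;
concluded here as `LineTarget`, definitionally the crux). -/
theorem transferActivityTails_of_weightedCountActivityTails (hW : WeightedCountActivityTails) : LineTarget := by
  intro a₀ θ₀ u₀ ha hθ hu ha0 hθ0
  obtain ⟨σ₁, hσ₁, H⟩ := hW a₀ θ₀ u₀ ha hθ hu ha0 hθ0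
  refine ⟨min σ₁ 2⁻¹, lt_min hσ₁ (by norm_num), ?_⟩
  intro σ hσ hσlt T ρ θ u hE Φ hlim t ht
  have hσ1 : σ < σ₁ := hσlt.trans_le (min_le_left _ _)
  have hσ2 : σ < 2⁻¹ := hσlt.trans_le (min_le_right _ _)
  obtain ⟨V₀, hV₀, HV⟩ := H σ hσ hσ1 T ρ θ u hE Φ hlim t ht
  refine ⟨V₀, hV₀, ?_⟩
  intro V hV ε hε
  have hVpos : 0 < V := hV₀.trans_le hV
  obtain ⟨τ₀, hτ₀, Hτ⟩ := HV V hV ε hε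
  refine ⟨τ₀, hτ₀, ?_⟩
  intro τ hτ
  have hτpos : 0 < τ := hτ₀.trans_le hτ
  obtain ⟨N₀, HN⟩ := Hτ τ hτ
  refine ⟨N₀, ?_⟩
  intro N hN s hs
  dsimp only
  set P := localGibbsLaw σ a₀ u₀ θ₀ N (Φ N) with hP
  have hκ : 0 ≤ σ / τ := div_nonneg hσ.le hτpos.le
  -- two facts about the tail functional `tailFn V y = 𝟙{V < y} y`
  have tailFn_nonneg' : ∀ y : ℝ, 0 ≤ tailFn V y := fun y =>
    Set.indicator_nonneg (fun _ (h : _ < _) => hVpos.le.trans h.le) _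
  have tailFn_mono' : ∀ {y y' : ℝ}, y ≤ y' → tailFn V y ≤ tailFn V y' := by
    intro y y' h
    by_cases hy : V < y
    · rw [tailFn_of_lt hy, tailFn_of_lt (hy.trans_le h)]
      exact h
    · rw [tailFn_of_le (not_lt.1 hy)]
      exact tailFn_nonneg' _
  -- the dominating functions `g i = tailFn V (b_i)`, `b_i = (σ/τ) W_i`
  set g : Fin (N + 1) → Cfg N → ℝ := fun i z => tailFn V (σ / τ * weightedCount (Φ N) τ s i z) with hg
  have hg0 : ∀ i z, 0 ≤ g i z := fun i z => tailFn_nonneg' _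
  have hgm : ∀ i, AEMeasurable (g i) P := fun i =>
    (measurable_tailFn V).comp_aemeasurable
      ((stub_weightedCountAEMeasurable σ hσ hσ2 a₀ θ₀ u₀ N (Φ N) τ s i).const_mul _)
  have hgi : ∀ i, ∫⁻ z, ENNReal.ofReal (g i z) ∂P ≤ ENNReal.ofReal ε := fun i => HN N hN s hs i
  -- pointwise a.e. domination of the crux integrand by the average of the `g i`
  have hgood : ∀ᵐ z ∂P, z ∈ (Φ N).good := ae_mem_good_localGibbsLaw σ a₀ θ₀ u₀ N (Φ N)
  have hptw : ∀ᵐ z ∂P, ((N : ℝ) + 1)⁻¹ * ∑ i : Fin (N + 1),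
      tailFn V (σ / τ * (Φ N).collisionSum (Set.Ioc s (s + window τ N)) (transferWeight i) z) ≤
      ((N : ℝ) + 1)⁻¹ * ∑ i : Fin (N + 1), g i z := by
    filter_upwards [hgood] with z hz
    refine mul_le_mul_of_nonneg_left (Finset.sum_le_sum fun i _ => ?_) (by positivity)
    exact tailFn_mono' (transferActivity_le_weightedCount hσ.le (Φ N) hz hτpos.le s i)
  calc ∫⁻ z, ENNReal.ofReal (((N : ℝ) + 1)⁻¹ * ∑ i : Fin (N + 1),
          tailFn V (σ / τ * (Φ N).collisionSum (Set.Ioc s (s + window τ N)) (transferWeight i) z)) ∂P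
      ≤ ∫⁻ z, ENNReal.ofReal (((N : ℝ) + 1)⁻¹ * ∑ i : Fin (N + 1), g i z) ∂P :=
        lintegral_mono_ae (hptw.mono fun z hz => ENNReal.ofReal_le_ofReal hz)
    _ ≤ ENNReal.ofReal ε := stub_meanTailAverage N P g (ENNReal.ofReal ε) hgm hg0 hgi

/-- **The crux by name**, from the registered open stub. -/
theorem TransferActivityTails_of :
    Summit.AtomisticToContinuum.HydrodynamicLimit.Theses.TwoClocks.TransferActivityTails :=
  transferActivityTails_of_weightedCountActivityTails stub_weightedCountActivityTails


/-- **The rung from the per-sphere second-moment rung** (`V₀ := A + 1`, `δ := ε/(A+1)`; pointwise Chebyshev). -/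
theorem weightedCountActivityTails_of_meanSquareRung (h : WeightedCountMeanSquareRung) :
    WeightedCountActivityTails := by
  intro a₀ θ₀ u₀ ha hθ hu ha0 hθ0
  obtain ⟨σ₀, hσ₀, H⟩ := h a₀ θ₀ u₀ ha hθ hu ha0 hθ0
  refine ⟨σ₀, hσ₀, ?_⟩
  intro σ hσ hσlt T ρ θ u hE Φ hlim t ht
  obtain ⟨A, hA, HA⟩ := H σ hσ hσlt T ρ θ u hE Φ hlim t ht
  refine ⟨A + 1, by linarith, ?_⟩
  intro V hV ε hε
  have hA1 : 0 < A + 1 := by linarith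
  obtain ⟨τ₀, hτ₀, Hτ⟩ := HA (ε / (A + 1)) (div_pos hε hA1)
  refine ⟨τ₀, hτ₀, ?_⟩
  intro τ hτ
  obtain ⟨N₀, HN⟩ := Hτ τ hτ
  refine ⟨N₀, ?_⟩
  intro N hN s hs i
  obtain ⟨m, hmA, hL⟩ := HN N hN s hs i
  set P := localGibbsLaw σ a₀ u₀ θ₀ N (Φ N)
  -- pointwise domination of the tail functional by the squared deviation
  have hptw : ∀ z, tailFn V (σ / τ * weightedCount (Φ N) τ s i z) ≤
      (A + 1) * (σ / τ * weightedCount (Φ N) τ s i z - m z) ^ 2 := fun z =>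
    tailFn_le_mul_sq hA.le (hmA z) hV
  calc ∫⁻ z, ENNReal.ofReal (tailFn V (σ / τ * weightedCount (Φ N) τ s i z)) ∂P
      ≤ ∫⁻ z, ENNReal.ofReal ((A + 1) * (σ / τ * weightedCount (Φ N) τ s i z - m z) ^ 2) ∂P :=
        lintegral_mono fun z => ENNReal.ofReal_le_ofReal (hptw z)
    _ = ∫⁻ z, ENNReal.ofReal (A + 1) *
          ENNReal.ofReal ((σ / τ * weightedCount (Φ N) τ s i z - m z) ^ 2) ∂P := by
        refine lintegral_congr fun z => ?_
        rw [ENNReal.ofReal_mul hA1.le]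
    _ = ENNReal.ofReal (A + 1) *
          ∫⁻ z, ENNReal.ofReal ((σ / τ * weightedCount (Φ N) τ s i z - m z) ^ 2) ∂P :=
        lintegral_const_mul' _ _ ENNReal.ofReal_ne_top
    _ ≤ ENNReal.ofReal (A + 1) * ENNReal.ofReal (ε / (A + 1)) := by
        gcongr
    _ = ENNReal.ofReal ε := by
        rw [← ENNReal.ofReal_mul hA1.le, mul_div_cancel₀ _ hA1.ne']

/-! ## §5 The PROVED reduction stub of the second-moment rung (lands as a tree file; register with `stub-add`) -/


/-- Stub (registered, PROVED; lands as `Theorems/TwoClocksTransferActivityTailsSecondMomentRung.lean`): the open stub from the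
per-sphere second-moment rung. -/
theorem stub_weightedCountActivityTails_of_meanSquareRung : WeightedCountMeanSquareRung → WeightedCountActivityTails :=
  fun h => weightedCountActivityTails_of_meanSquareRung h


end Summit.AtomisticToContinuum.HydrodynamicLimit.Theorems.TransferActivityTailsTaggedCount

end
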